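import Summits.HodgeConjecture.HodgeConjecture.Theorems.F0P3IsotypicOfCogenerated      -- ★ R2♯ (p04 g4): finitely cogenerated ⇒ isotypic
import Summits.HodgeConjecture.HodgeConjecture.Theorems.F0P3FinComponentAdmissible    -- ★ (A4c) (p04 g4) §2: `isClosed_fixedPoints`, `starProjection_fixedPoints_eq_avg`
import Summits.HodgeConjecture.HodgeConjecture.Theorems.F0P3HilbertProjection         -- ★ (p02 g0): `orthogonalProjectionOnto_map`
import Mathlib.RepresentationTheory.Irreducible
import HarnessLib

/-!
# Crux `H413` — rung 3, brick I♭ (generic half): the SMOOTH PART of the restriction of a unitary Hilbert representation to a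
# totally disconnected group is ISOTYPIC SEMISIMPLE of type `σ` as soon as an irreducible ADMISSIBLE `σ` occurs in it and the
# commutant spreads the occurrence densely («finite-part isotypy from one admissible occurrence»)

Floor-0 programme P3 «U3-mult», seat F0P3-p03 (g5); crux item stmt-HodgeConjecture-24833 (`HCCMUnconditional.H413`); F0P3-plan (g3)
rulings (N6)/(R) 2026-08-31: road I♭ → Σ♭ → T♭ for the in-house TRANSFER fact T♭ (`MemAPacket P ξ`, common finite component `σ` ⇒
`MemAPacket P′ ξ`) in the SMOOTH-PART currency (b2′).  GENERIC Hilbert-space / ring theory — no automorphic object occurs; the automorphic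
instance (`π = P.space.toContRep`, `β = finAdelicToAdelic`, commutant ⊇ the archimedean factor) is the sequel `F0P3FinPartIsotypic`.
PROOF lane: no `def`, no `sorry`, no named fact; `--supports stmt-HodgeConjecture-24833`.
HONEST LABEL: HC_CM is proved only modulo the printed citations until rung 0 closes; this file discharges none of them.

SETTING.  `π` a UNITARY continuous representation of a group `Γ` on a complex Hilbert space `H`; `β : B →* Γ` with `B` a topological group
possessing a compact open subgroup `K₀`; `ρ := π ∘ β` (Mathlib `Representation`, no topology on `H` used by it); `σ` an irreducible
ADMISSIBLE representation of `B` on `W` with an injective `B`-map `f : W → H`; `𝒯` a set of continuous operators on `H` commuting with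
`ρ(B)` such that the translates `T(f(W))`, `T ∈ 𝒯`, span a DENSE subspace of `H`.

THE ARGUMENT (the F1b road's R2♯ «cogeneration ⇒ isotypy» with the factor roles swapped).
§1 `map_avg`: equivariant linear maps commute with the finite averaging operator `e_K` on smooth vectors (★ `SmoothProjector.avg`).
§2 `closure_range_inf_fixedPoints_le`: for an equivariant `g : W → H`, `cl(g(W)) ∩ H^K ⊆ g(W^K)` when `W^K` is finite-dimensional — the
   orthogonal projection onto the closed `H^K` is `e_K` on smooth vectors (★ `starProjection_fixedPoints_eq_avg`), maps `g(W)` into the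
   finite-dimensional, hence closed, `g(W^K)`, and is continuous.  Hence `cl(g(W))` meets the smooth part of `ρ` inside `g(W)`
   (`closure_range_inf_smoothPart_le`).
§3 For `T ∈ 𝒯` with `T ∘ f ≠ 0` (then injective, `σ` irreducible) the orthogonal projection `p_T` onto `cl(T f(W))` is `B`-equivariant
   (★ `orthogonalProjectionOnto_map`) and maps smooth vectors to `T f(W)`; `φ_T := (T f)⁻¹ ∘ p_T` is a `B`-map `ρ^∞ → σ`
   (`exists_equivariant_apply_ne_zero`), non-zero at a given smooth `x ≠ 0` for a suitable `T` by density (`x ⊥ cl(T f(W))` for all `T`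
   forces `x = 0`).
§4 Every `ℂ[B]`-linear `ψ : ρ^∞ → σ` maps `x ∈ H^K` into the finite-dimensional `σ^K` (admissibility), so ★ R2♯
   `exists_finset_of_cogenerated` + `isotypicComponent_eq_top_of_finitely_cogenerated` give the HEAD
   **`isotypicComponent_smoothPart_eq_top`**: `isotypicComponent ℂ[B] (ρ.smoothPart) σ = ⊤`, with corollaries `isSemisimpleModule_smoothPart`,
   `isIsotypicOfType_smoothPart` (Bourbaki's isotypic currency on `Representation.asModule`).

References: I. N. Bernstein, A. V. Zelevinsky, *Representations of the group GL(n,F) where F is a non-archimedean local field*, Russian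
Math. Surveys 31 (1976), §2.1–2.3 (smooth part, `e_K`, admissibility) [BernsteinZelevinsky1976]; N. Bourbaki, *Algèbre* VIII (2012) §4 n°1–2
[BourbakiAlgebreVIII2012]; A. Borel, H. Jacquet, PSPM 33.1 (1979) §4.6 (projections in `L²_d` commute with `G(𝔸_f)`) [BorelJacquet1979];
D. Flath, PSPM 33.1 (1979) Thm. 3–4 (the statement this replaces in-house: isotypy of the finite part) [FlathCorvallis1979].
-/

set_option autoImplicit false
-- the mandated namespace repeats `HodgeConjecture.HodgeConjecture`, as in every `Theorems/*.lean` of this sub-problem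
set_option linter.dupNamespace false

noncomputable section

open scoped InnerProductSpace

namespace Summit.HodgeConjecture.HodgeConjecture.Cruxes.H413.F0P3SmoothPartIsotypic

open Literature.NumberTheory.Automorphic.SmoothProjector
open Summit.HodgeConjecture.HodgeConjecture.Cruxes.H413.F0P3IsotypicOfCogenerated
open Summit.HodgeConjecture.HodgeConjecture.Cruxes.H413.F0P3FinComponentAdmissible
open Summit.HodgeConjecture.HodgeConjecture.Cruxes.H413.F0P3HilbertProjection

/-! ## §1 Equivariant maps commute with the averaging operator `e_K` on smooth vectors -/

section Avg

variable {B : Type*} [Group B] [TopologicalSpace B] [IsTopologicalGroup B]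
  {W V : Type*} [AddCommGroup W] [Module ℂ W] [AddCommGroup V] [Module ℂ V]

/-- A `B`-equivariant linear map sends smooth vectors to smooth vectors (the stabiliser can only grow). [cite: BernsteinZelevinsky1976, §2.1] -/
theorem isSmoothVector_map (σ : Representation ℂ B W) (ρ : Representation ℂ B V) (g : W →ₗ[ℂ] V)
    (hg : ∀ (b : B) (w : W), g (σ b w) = ρ b (g w)) {w : W} (hw : σ.IsSmoothVector w) : ρ.IsSmoothVector (g w) := by
  refine ρ.isSmoothVector_of_le hw fun b hb => ?_
  rw [Representation.mem_stabilizerSubgroup] at hb ⊢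
  rw [← hg, hb]

/-- **`g (e_K w) = e_K (g w)`** for a `B`-equivariant linear `g`, `K` compact and `w` smooth: both averages are computed on the finite-index
stabiliser of `w` in `K` (★ `avg_eq_index_inv_smul_finsum`), which also stabilises `g w`. [cite: BernsteinZelevinsky1976, §2.3] -/
theorem map_avg (σ : Representation ℂ B W) (ρ : Representation ℂ B V) (g : W →ₗ[ℂ] V)
    (hg : ∀ (b : B) (w : W), g (σ b w) = ρ b (g w)) {K : Subgroup B} (hK : IsCompact (K : Set B)) {w : W}
    (hw : σ.IsSmoothVector w) : g (avg σ K w) = avg ρ K (g w) := by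
  haveI := finiteIndex_stabIn hK hw
  haveI : Fintype (K ⧸ stabIn σ K w) := Fintype.ofFinite _
  have hle : stabIn σ K w ≤ stabIn ρ K (g w) := fun b hb => by
    refine Subgroup.mem_subgroupOf.2 ?_
    have hb' : σ (b : B) w = w := Subgroup.mem_subgroupOf.1 hb
    rw [Representation.mem_stabilizerSubgroup, ← hg, hb']
  rw [avg_eq_index_inv_smul_finsum (stabIn σ K w) le_rfl, avg_eq_index_inv_smul_finsum (stabIn σ K w) hle,
    finsum_eq_sum_of_fintype, finsum_eq_sum_of_fintype, map_smul, map_sum]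
  congr 1
  exact Finset.sum_congr rfl fun q _ => hg _ _

end Avg

/-! ## §2 Closures of equivariant images meet the `K`-fixed vectors inside the image of `W^K` -/

section Closure

variable {Γ B : Type*} [Group Γ] [Group B] [TopologicalSpace B] [IsTopologicalGroup B]
  {H : Type*} [NormedAddCommGroup H] [InnerProductSpace ℂ H] [CompleteSpace H]
  {W : Type*} [AddCommGroup W] [Module ℂ W]

/-- **`cl(g(W)) ∩ H^K ⊆ g(W^K)`** for `π` unitary, `g : W → H` equivariant along `β`, `σ` smooth, `K` compact and `W^K` finite-dimensional: the
orthogonal projection `Q` onto the closed `H^K` fixes the left side, is continuous, and is the finite average `e_K` on the smooth vectors `g w`,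
so `Q(g(W)) ⊆ g(e_K W) ⊆ g(W^K)`, a finite-dimensional hence closed subspace. [cite: BernsteinZelevinsky1976, §2.3] [cite: BorelJacquet1979, §4.6] -/
theorem closure_range_inf_fixedPoints_le (π : ContRepresentation ℂ Γ H) (hπ : π.IsUnitary) (β : B →* Γ)
    (σ : Representation ℂ B W) (hσ : σ.IsSmooth) (g : W →ₗ[ℂ] H) (hg : ∀ (b : B) (w : W), g (σ b w) = π (β b) (g w))
    {K : Subgroup B} (hK : IsCompact (K : Set B)) [FiniteDimensional ℂ (σ.fixedPoints K)] :
    (LinearMap.range g).topologicalClosure ⊓ Representation.fixedPoints (π.toRepresentation.comp β) K ≤ (σ.fixedPoints K).map g := by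
  set ρ : Representation ℂ B H := π.toRepresentation.comp β with hρ
  have hg' : ∀ (b : B) (w : W), g (σ b w) = ρ b (g w) := hg
  set F : Submodule ℂ H := ρ.fixedPoints K with hF
  haveI : CompleteSpace F := (isClosed_fixedPoints π β K).completeSpace_coe
  haveI : F.HasOrthogonalProjection := Submodule.HasOrthogonalProjection.ofCompleteSpace F
  set F' : Submodule ℂ H := (σ.fixedPoints K).map g with hF'
  haveI : FiniteDimensional ℂ F' := Module.Finite.map _ _
  rintro x ⟨hxC, hxF⟩
  have hQx : F.starProjection x = x := Submodule.starProjection_eq_self_iff.mpr hxF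
  -- `Q (g w) = g (e_K w) ∈ g(W^K)`
  have hQg : ∀ w : W, F.starProjection (g w) ∈ F' := fun w => by
    have hsm : ρ.IsSmoothVector (g w) := isSmoothVector_map σ ρ g hg' (hσ w)
    rw [starProjection_fixedPoints_eq_avg π hπ β hK hsm, ← hρ, ← map_avg σ ρ g hg' hK (hσ w)]
    exact Submodule.mem_map_of_mem (avg_mem_fixedPoints hK (hσ w))
  -- `Q (range g) ⊆ F'`, closed
  have hsub : (F.starProjection : H → H) '' ((LinearMap.range g : Submodule ℂ H) : Set H) ⊆ (F' : Set H) := by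
    rintro _ ⟨_, ⟨w, rfl⟩, rfl⟩
    exact hQg w
  have himg : F.starProjection x ∈ closure ((F.starProjection : H → H) '' ((LinearMap.range g : Submodule ℂ H) : Set H)) :=
    image_closure_subset_closure_image F.starProjection.continuous
      ⟨x, by simpa only [Submodule.topologicalClosure_coe] using hxC, rfl⟩
  have hclosed : IsClosed (F' : Set H) := F'.closed_of_finiteDimensional
  rw [← hQx]
  exact hclosed.closure_subset_iff.mpr hsub himg

/-- **`cl(g(W)) ∩ H^∞ ⊆ g(W)`**: a SMOOTH vector in the closure of an equivariant image of an ADMISSIBLE `σ` already lies in the image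
(its stabiliser contains the compact open `K₀ ⊓ Stab`, whose fixed vectors in `W` are finite-dimensional).
[cite: BernsteinZelevinsky1976, §2.1–2.3] -/
theorem closure_range_inf_smoothPart_le (π : ContRepresentation ℂ Γ H) (hπ : π.IsUnitary) (β : B →* Γ)
    {K₀ : Subgroup B} (hK₀o : IsOpen (K₀ : Set B)) (hK₀c : IsCompact (K₀ : Set B))
    (σ : Representation ℂ B W) (hadm : σ.IsAdmissible) (g : W →ₗ[ℂ] H) (hg : ∀ (b : B) (w : W), g (σ b w) = π (β b) (g w))
    {x : H} (hxC : x ∈ (LinearMap.range g).topologicalClosure)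
    (hx : Representation.IsSmoothVector (π.toRepresentation.comp β) x) : x ∈ LinearMap.range g := by
  set ρ : Representation ℂ B H := π.toRepresentation.comp β with hρ
  -- the compact open subgroup `K := K₀ ⊓ Stab(x)` fixes `x`
  set K : Subgroup B := K₀ ⊓ ρ.stabilizerSubgroup x with hKdef
  have hKo : IsOpen (K : Set B) := hK₀o.inter hx
  have hKc : IsCompact (K : Set B) := by
    have hcl : IsClosed (K : Set B) := (⟨K, hKo⟩ : OpenSubgroup B).isClosed
    exact hK₀c.of_isClosed_subset hcl (fun b hb => hb.1)
  have hxK : x ∈ ρ.fixedPoints K := (Representation.mem_fixedPoints _ _ _).mpr fun b hb =>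
    (Representation.mem_stabilizerSubgroup _ _ _).mp hb.2
  haveI : FiniteDimensional ℂ (σ.fixedPoints K) := hadm.finite_fixedPoints ⟨K, hKo⟩ hKc
  obtain ⟨w, -, hw⟩ := closure_range_inf_fixedPoints_le π hπ β σ hadm.isSmooth g hg hKc ⟨hxC, hxK⟩
  exact ⟨w, hw⟩

end Closure

/-! ## §3 The cogenerating `B`-maps `φ_T = (T f)⁻¹ ∘ p_T : ρ^∞ → σ` -/

section Cogeneration

variable {Γ B : Type*} [Group Γ] [Group B] [TopologicalSpace B] [IsTopologicalGroup B]
  {H : Type*} [NormedAddCommGroup H] [InnerProductSpace ℂ H] [CompleteSpace H]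
  {W : Type*} [AddCommGroup W] [Module ℂ W]

omit [TopologicalSpace B] [IsTopologicalGroup B] [CompleteSpace H] in
/-- The continuous representation `π ∘ β` of `B` (Mathlib `ContRepresentation.ofMonoidHom`); its `toRepresentation` is `π.toRepresentation ∘ β`
definitionally. [folklore] -/
theorem toRepresentation_ofMonoidHom_comp (π : ContRepresentation ℂ Γ H) (β : B →* Γ) :
    (ContRepresentation.ofMonoidHom (π.toMonoidHom.comp β)).toRepresentation = π.toRepresentation.comp β := rfl

omit [TopologicalSpace B] [IsTopologicalGroup B] in
/-- `π ∘ β` is unitary when `π` is. [folklore] -/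
theorem isUnitary_ofMonoidHom_comp {π : ContRepresentation ℂ Γ H} (hπ : π.IsUnitary) (β : B →* Γ) :
    (ContRepresentation.ofMonoidHom (π.toMonoidHom.comp β)).IsUnitary := fun b => hπ (β b)

/-- **The cogenerating maps.**  `π` unitary, `σ` irreducible admissible with an equivariant `f : W → H`, `T` a continuous operator commuting
with `π(β(B))`, and a SMOOTH vector `x` NOT orthogonal to `cl(T f(W))`: there is a `B`-equivariant linear `φ : H^∞ → W` (on the smooth part
of `π ∘ β`) with `φ x ≠ 0` — namely `(T f)⁻¹ ∘ p_T`, `p_T` the orthogonal projection onto `cl(T f(W))` (equivariant, ★ `orthogonalProjectionOnto_map`;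
smooth values lie in `T f(W)` by §2; `T ∘ f` is injective, being a non-zero `B`-map out of the irreducible `σ`).
[cite: BernsteinZelevinsky1976, §2.1–2.3] [cite: BorelJacquet1979, §4.6] [cite: BourbakiAlgebreVIII2012, VIII §4 n°2] -/
theorem exists_equivariant_apply_ne_zero (π : ContRepresentation ℂ Γ H) (hπ : π.IsUnitary) (β : B →* Γ)
    {K₀ : Subgroup B} (hK₀o : IsOpen (K₀ : Set B)) (hK₀c : IsCompact (K₀ : Set B))
    (σ : Representation ℂ B W) [σ.IsIrreducible] (hadm : σ.IsAdmissible)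
    (f : W →ₗ[ℂ] H) (hf : ∀ (b : B) (w : W), f (σ b w) = π (β b) (f w))
    (T : H →L[ℂ] H) (hT : ∀ (b : B) (y : H), T (π (β b) y) = π (β b) (T y))
    (x : ↥(Representation.smoothPart (π.toRepresentation.comp β)).toSubmodule)
    (hx : (x : H) ∉ ((LinearMap.range (T.toLinearMap ∘ₗ f)).topologicalClosure)ᗮ) :
    ∃ φ : ↥(Representation.smoothPart (π.toRepresentation.comp β)).toSubmodule →ₗ[ℂ] W,
      (∀ (b : B) (y : ↥(Representation.smoothPart (π.toRepresentation.comp β)).toSubmodule),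
          φ ((Representation.smoothPart (π.toRepresentation.comp β)).toRepresentation b y) = σ b (φ y)) ∧ φ x ≠ 0 := by
  let ρ : Representation ℂ B H := π.toRepresentation.comp β
  set g : W →ₗ[ℂ] H := T.toLinearMap ∘ₗ f with hgdef
  have hg : ∀ (b : B) (w : W), g (σ b w) = π (β b) (g w) := fun b w => by
    simp only [hgdef, LinearMap.coe_comp, Function.comp_apply, ContinuousLinearMap.coe_coe, hf, hT]
  -- the closed invariant subspace `C = cl(g(W))` as a closed subrepresentation of the unitary `π ∘ β`
  set πB : ContRepresentation ℂ B H := ContRepresentation.ofMonoidHom (π.toMonoidHom.comp β) with hπB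
  have hπBu : πB.IsUnitary := isUnitary_ofMonoidHom_comp hπ β
  have hπBapp : ∀ b : B, πB b = π (β b) := fun b => rfl
  have hCinv : ∀ (b : B) (y : H), y ∈ (LinearMap.range g).topologicalClosure →
      π (β b) y ∈ (LinearMap.range g).topologicalClosure := fun b y hy => by
    have hsub : (π (β b) : H → H) '' ((LinearMap.range g : Submodule ℂ H) : Set H) ⊆ ((LinearMap.range g : Submodule ℂ H) : Set H) := by
      rintro _ ⟨_, ⟨w, rfl⟩, rfl⟩
      exact ⟨σ b w, hg b w⟩
    have hy' : y ∈ closure ((LinearMap.range g : Submodule ℂ H) : Set H) := by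
      rwa [← Submodule.topologicalClosure_coe]
    have h1 : π (β b) y ∈ closure ((π (β b) : H → H) '' ((LinearMap.range g : Submodule ℂ H) : Set H)) :=
      image_closure_subset_closure_image (π (β b)).continuous ⟨y, hy', rfl⟩
    have h2 := closure_mono hsub h1
    rwa [← Submodule.topologicalClosure_coe] at h2
  let C : ContRepresentation.ClosedSubrep πB :=
    { toSubmodule := (LinearMap.range g).topologicalClosure
      apply_mem_toSubmodule := fun b y hy => hCinv b y hy
      isClosed' := Submodule.isClosed_topologicalClosure _ }
  have hCsub : C.toSubmodule = (LinearMap.range g).topologicalClosure := rfl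
  -- `g ≠ 0`, hence injective (`σ` irreducible)
  have hg0 : g ≠ 0 := by
    intro h0
    apply hx
    have hbot : LinearMap.range g = ⊥ := by rw [h0, LinearMap.range_zero]
    rw [hbot, (Submodule.closed_of_finiteDimensional (⊥ : Submodule ℂ H)).submodule_topologicalClosure_eq,
      Submodule.bot_orthogonal_eq_top]
    trivial
  let gI : σ.IntertwiningMap ρ := g.intertwiningMap_of_isIntertwiningMap σ ρ hg
  have hgI : (gI : W → H) = g := rfl
  have hginj : Function.Injective g := by
    have hor := Representation.IsIrreducible.injective_or_eq_zero gI
    rcases hor with h | h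
    · rwa [← hgI]
    · refine absurd (LinearMap.ext fun w => ?_) hg0
      have h1 := congrArg (fun F : σ.IntertwiningMap ρ => (F : W → H) w) h
      simpa only [hgI, Representation.IntertwiningMap.coe_zero, Pi.zero_apply, LinearMap.zero_apply] using h1
  -- the projection `p = pr_C` is equivariant and maps smooth vectors into `range g`
  haveI : CompleteSpace C.toSubmodule := (Submodule.isClosed_topologicalClosure _).completeSpace_coe
  haveI : C.toSubmodule.HasOrthogonalProjection := Submodule.HasOrthogonalProjection.ofCompleteSpace _
  have hpeq : ∀ (b : B) (y : H),
      (C.toSubmodule.orthogonalProjectionOnto (π (β b) y) : H) = π (β b) (C.toSubmodule.orthogonalProjectionOnto y : H) :=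
    fun b y => by rw [← hπBapp]; exact orthogonalProjectionOnto_map hπBu C b y
  have hpsm : ∀ y : ↥ρ.smoothPart.toSubmodule, ρ.IsSmoothVector (C.toSubmodule.orthogonalProjectionOnto (y : H) : H) := fun y => by
    refine ρ.isSmoothVector_of_le y.2 fun b hb => ?_
    rw [Representation.mem_stabilizerSubgroup] at hb ⊢
    change π (β b) _ = _
    rw [← hpeq, show π (β b) (y : H) = ρ b (y : H) from rfl, hb]
  have hprange : ∀ y : ↥ρ.smoothPart.toSubmodule, (C.toSubmodule.orthogonalProjectionOnto (y : H) : H) ∈ LinearMap.range g := fun y =>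
    closure_range_inf_smoothPart_le π hπ β hK₀o hK₀c σ hadm g hg (C.toSubmodule.orthogonalProjectionOnto (y : H)).2 (hpsm y)
  -- `φ := g⁻¹ ∘ p` on the smooth part
  let p₀ : ↥ρ.smoothPart.toSubmodule →ₗ[ℂ] H := C.toSubmodule.subtype ∘ₗ (C.toSubmodule.orthogonalProjectionOnto : H →ₗ[ℂ] C.toSubmodule) ∘ₗ
    ρ.smoothPart.toSubmodule.subtype
  have hp₀ : ∀ y : ↥ρ.smoothPart.toSubmodule, p₀ y = (C.toSubmodule.orthogonalProjectionOnto (y : H) : H) := fun y => rfl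
  let p₁ : ↥ρ.smoothPart.toSubmodule →ₗ[ℂ] ↥(LinearMap.range g) := LinearMap.codRestrict (LinearMap.range g) p₀ fun y => by
    rw [hp₀]; exact hprange y
  let e : W ≃ₗ[ℂ] ↥(LinearMap.range g) := LinearEquiv.ofInjective g hginj
  let φ : ↥ρ.smoothPart.toSubmodule →ₗ[ℂ] W := e.symm.toLinearMap ∘ₗ p₁
  have hgφ : ∀ y : ↥ρ.smoothPart.toSubmodule, g (φ y) = (C.toSubmodule.orthogonalProjectionOnto (y : H) : H) := fun y => by
    have h1 : ((e (e.symm (p₁ y)) : ↥(LinearMap.range g)) : H) = (p₁ y : H) := by rw [LinearEquiv.apply_symm_apply]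
    rw [LinearEquiv.ofInjective_apply] at h1
    exact h1
  refine ⟨φ, fun b y => hginj ?_, fun h0 => hx ?_⟩
  · -- equivariance, checked after `g`
    rw [hg, hgφ, hgφ, ← hpeq]
    rfl
  · -- `φ x = 0` ⇒ `p x = 0` ⇒ `x ⊥ C`
    have hp0 : (C.toSubmodule.orthogonalProjectionOnto (x : H) : H) = 0 := by rw [← hgφ, h0, map_zero]
    have : C.toSubmodule.orthogonalProjectionOnto (x : H) = 0 := Subtype.ext hp0
    rwa [Submodule.orthogonalProjectionOnto_eq_zero_iff, hCsub] at this

end Cogeneration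

/-! ## §4 The HEAD: the smooth part is `σ`-isotypic semisimple -/

section Head

open scoped MonoidAlgebra

variable {Γ B : Type*} [Group Γ] [Group B] [TopologicalSpace B] [IsTopologicalGroup B]
  {H : Type*} [NormedAddCommGroup H] [InnerProductSpace ℂ H] [CompleteSpace H]
  {W : Type*} [AddCommGroup W] [Module ℂ W]

omit [TopologicalSpace B] [IsTopologicalGroup B] in
/-- **Values of `ℂ[B]`-linear maps at a `K`-fixed vector are `K`-fixed.** [folklore] -/
theorem apply_mem_fixedPoints_of_mem {V : Type*} [AddCommGroup V] [Module ℂ V] (ρ : Representation ℂ B V) (σ : Representation ℂ B W)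
    (ψ : ρ.asModule →ₗ[ℂ[B]] σ.asModule) {K : Subgroup B} {x : V} (hx : x ∈ ρ.fixedPoints K) :
    σ.asModuleEquiv (ψ (ρ.asModuleEquiv.symm x)) ∈ σ.fixedPoints K := by
  rw [Representation.mem_fixedPoints] at hx ⊢
  intro b hb
  have h1 : MonoidAlgebra.of ℂ B b • ρ.asModuleEquiv.symm x = ρ.asModuleEquiv.symm x := by
    rw [← Representation.asModuleEquiv_symm_map_rho, hx b hb]
  have h2 := congrArg ψ h1
  rw [map_smul] at h2
  have h3 := congrArg σ.asModuleEquiv h2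
  rw [Representation.asModuleEquiv_map_smul, Representation.asAlgebraHom_of] at h3
  exact h3

/-- **HEAD — the smooth part of `π ∘ β` is `σ`-ISOTYPIC**: `isotypicComponent ℂ[B] (π ∘ β)^∞ σ = ⊤`.  Hypotheses: `π` unitary on a Hilbert
space; `B` has a compact open subgroup `K₀`; `σ` irreducible admissible with an injective equivariant `f : W → H`; `𝒯` continuous operators
commuting with `π(β(B))` whose translates `T f(W)` span a dense subspace.  Proof: cogeneration of the smooth part by the `B`-maps of §3
(density), finite-dimensional values at each smooth `x ∈ H^K` (`σ^K`, admissibility), ★ R2♯. [cite: BourbakiAlgebreVIII2012, VIII §4 n°1–2]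
[cite: BernsteinZelevinsky1976, §2.1–2.3] [cite: FlathCorvallis1979, Thm. 3] -/
theorem isotypicComponent_smoothPart_eq_top (π : ContRepresentation ℂ Γ H) (hπ : π.IsUnitary) (β : B →* Γ)
    {K₀ : Subgroup B} (hK₀o : IsOpen (K₀ : Set B)) (hK₀c : IsCompact (K₀ : Set B))
    (σ : Representation ℂ B W) [σ.IsIrreducible] (hadm : σ.IsAdmissible)
    (f : W →ₗ[ℂ] H) (hf : ∀ (b : B) (w : W), f (σ b w) = π (β b) (f w))
    (𝒯 : Set (H →L[ℂ] H)) (h𝒯 : ∀ T ∈ 𝒯, ∀ (b : B) (y : H), T (π (β b) y) = π (β b) (T y))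
    (hdense : (⨆ T ∈ 𝒯, LinearMap.range (T.toLinearMap ∘ₗ f)).topologicalClosure = ⊤) :
    isotypicComponent ℂ[B] ((Representation.smoothPart (π.toRepresentation.comp β)).toRepresentation).asModule σ.asModule = ⊤ := by
  let ρ : Representation ℂ B H := π.toRepresentation.comp β
  let ρs : Representation ℂ B ↥ρ.smoothPart.toSubmodule := ρ.smoothPart.toRepresentation
  haveI : IsSimpleModule ℂ[B] σ.asModule := (Representation.irreducible_iff_isSimpleModule_asModule σ).mp inferInstance
  -- (a) cogeneration by `ℂ[B]`-linear maps
  have hcog : ∀ m : ρs.asModule, m ≠ 0 → ∃ ψ : ρs.asModule →ₗ[ℂ[B]] σ.asModule, ψ m ≠ 0 := by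
    intro m hm
    set x : ↥ρ.smoothPart.toSubmodule := ρs.asModuleEquiv m with hxdef
    have hx0 : (x : H) ≠ 0 := fun h => hm (by
      have : x = 0 := Subtype.ext h
      simpa [hxdef] using this)
    -- density: `x` is not orthogonal to every `cl(T f(W))`
    have hT : ∃ T ∈ 𝒯, (x : H) ∉ ((LinearMap.range (T.toLinearMap ∘ₗ f)).topologicalClosure)ᗮ := by
      by_contra hcon
      push Not at hcon
      apply hx0
      have hle : (⨆ T ∈ 𝒯, LinearMap.range (T.toLinearMap ∘ₗ f)) ≤ (ℂ ∙ (x : H))ᗮ := by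
        refine iSup₂_le fun T hTm => ?_
        have h1 : (x : H) ∈ (LinearMap.range (T.toLinearMap ∘ₗ f))ᗮ :=
          Submodule.orthogonal_le (Submodule.le_topologicalClosure _) (hcon T hTm)
        intro y hy
        rw [Submodule.mem_orthogonal] at h1
        exact (Submodule.mem_orthogonal_singleton_iff_inner_left).mpr (h1 y hy)
      have hxo : (x : H) ∈ (⨆ T ∈ 𝒯, LinearMap.range (T.toLinearMap ∘ₗ f))ᗮ :=
        Submodule.orthogonal_le hle (Submodule.le_orthogonal_orthogonal _ (Submodule.mem_span_singleton_self (x : H)))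
      have h2 : ((⨆ T ∈ 𝒯, LinearMap.range (T.toLinearMap ∘ₗ f))ᗮ) = ⊥ := Submodule.topologicalClosure_eq_top_iff.mp hdense
      rw [h2] at hxo
      exact (Submodule.mem_bot ℂ).mp hxo
    obtain ⟨T, hTm, hxT⟩ := hT
    have hex := exists_equivariant_apply_ne_zero π hπ β hK₀o hK₀c σ hadm f hf T (h𝒯 T hTm) x hxT
    obtain ⟨φ, hφ, hφx⟩ := hex
    let φI : ρs.IntertwiningMap σ := φ.intertwiningMap_of_isIntertwiningMap ρs σ hφ
    refine ⟨Representation.IntertwiningMap.equivLinearMapAsModule ρs σ φI, ?_⟩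
    change σ.asModuleEquiv.symm (φ (ρs.asModuleEquiv m)) ≠ 0
    rw [map_ne_zero_iff _ σ.asModuleEquiv.symm.injective, ← hxdef]
    exact hφx
  -- (b) finite-dimensional values at each `m`, then ★ R2♯
  refine isotypicComponent_eq_top_of_finitely_cogenerated fun m => ?_
  set x : ↥ρ.smoothPart.toSubmodule := ρs.asModuleEquiv m with hxdef
  set K : Subgroup B := K₀ ⊓ ρ.stabilizerSubgroup (x : H) with hKdef
  have hKo : IsOpen (K : Set B) := hK₀o.inter x.2
  have hKc : IsCompact (K : Set B) := by
    have hcl : IsClosed (K : Set B) := (⟨K, hKo⟩ : OpenSubgroup B).isClosed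
    exact hK₀c.of_isClosed_subset hcl (fun b hb => hb.1)
  have hxK : x ∈ ρs.fixedPoints K := (Representation.mem_fixedPoints _ _ _).mpr fun b hb =>
    Subtype.ext ((Representation.mem_stabilizerSubgroup _ _ _).mp hb.2)
  haveI : FiniteDimensional ℂ (σ.fixedPoints K) := hadm.finite_fixedPoints ⟨K, hKo⟩ hKc
  let E : Submodule ℂ σ.asModule := (σ.fixedPoints K).map (σ.asModuleEquiv.symm : W →ₗ[ℂ] σ.asModule)
  haveI : FiniteDimensional ℂ E := Module.Finite.map _ _
  refine exists_finset_of_cogenerated (k := ℂ) hcog m E fun ψ => ?_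
  have hval := apply_mem_fixedPoints_of_mem ρs σ ψ hxK
  rw [hxdef, LinearEquiv.symm_apply_apply] at hval
  exact ⟨_, hval, by simp⟩

/-- Corollary: the smooth part of `π ∘ β` is a SEMISIMPLE `ℂ[B]`-module. [cite: BourbakiAlgebreVIII2012, VIII §4 n°1 Prop. 2] -/
theorem isSemisimpleModule_smoothPart (π : ContRepresentation ℂ Γ H) (hπ : π.IsUnitary) (β : B →* Γ)
    {K₀ : Subgroup B} (hK₀o : IsOpen (K₀ : Set B)) (hK₀c : IsCompact (K₀ : Set B))
    (σ : Representation ℂ B W) [σ.IsIrreducible] (hadm : σ.IsAdmissible)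
    (f : W →ₗ[ℂ] H) (hf : ∀ (b : B) (w : W), f (σ b w) = π (β b) (f w))
    (𝒯 : Set (H →L[ℂ] H)) (h𝒯 : ∀ T ∈ 𝒯, ∀ (b : B) (y : H), T (π (β b) y) = π (β b) (T y))
    (hdense : (⨆ T ∈ 𝒯, LinearMap.range (T.toLinearMap ∘ₗ f)).topologicalClosure = ⊤) :
    IsSemisimpleModule ℂ[B] ((Representation.smoothPart (π.toRepresentation.comp β)).toRepresentation).asModule := by
  haveI : IsSimpleModule ℂ[B] σ.asModule := (Representation.irreducible_iff_isSimpleModule_asModule σ).mp inferInstance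
  have htop := isotypicComponent_smoothPart_eq_top π hπ β hK₀o hK₀c σ hadm f hf 𝒯 h𝒯 hdense
  let e : ((Representation.smoothPart (π.toRepresentation.comp β)).toRepresentation).asModule ≃ₗ[ℂ[B]]
      ↥(isotypicComponent ℂ[B] ((Representation.smoothPart (π.toRepresentation.comp β)).toRepresentation).asModule σ.asModule) :=
    (LinearEquiv.ofTop _ htop).symm
  exact IsSemisimpleModule.congr (R := ℂ[B]) (N := ((Representation.smoothPart (π.toRepresentation.comp β)).toRepresentation).asModule)
    (M := ↥(isotypicComponent ℂ[B] ((Representation.smoothPart (π.toRepresentation.comp β)).toRepresentation).asModule σ.asModule)) e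

/-- Corollary: the smooth part of `π ∘ β` is ISOTYPIC OF TYPE `σ` — every simple `ℂ[B]`-submodule is isomorphic to `σ`.
[cite: BourbakiAlgebreVIII2012, VIII §4 n°1 Prop. 2] [cite: FlathCorvallis1979, Thm. 3] -/
theorem isIsotypicOfType_smoothPart (π : ContRepresentation ℂ Γ H) (hπ : π.IsUnitary) (β : B →* Γ)
    {K₀ : Subgroup B} (hK₀o : IsOpen (K₀ : Set B)) (hK₀c : IsCompact (K₀ : Set B))
    (σ : Representation ℂ B W) [σ.IsIrreducible] (hadm : σ.IsAdmissible)
    (f : W →ₗ[ℂ] H) (hf : ∀ (b : B) (w : W), f (σ b w) = π (β b) (f w))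
    (𝒯 : Set (H →L[ℂ] H)) (h𝒯 : ∀ T ∈ 𝒯, ∀ (b : B) (y : H), T (π (β b) y) = π (β b) (T y))
    (hdense : (⨆ T ∈ 𝒯, LinearMap.range (T.toLinearMap ∘ₗ f)).topologicalClosure = ⊤) :
    IsIsotypicOfType ℂ[B] ((Representation.smoothPart (π.toRepresentation.comp β)).toRepresentation).asModule σ.asModule := by
  haveI : IsSimpleModule ℂ[B] σ.asModule := (Representation.irreducible_iff_isSimpleModule_asModule σ).mp inferInstance
  exact IsIsotypicOfType.of_isotypicComponent_eq_top
    (isotypicComponent_smoothPart_eq_top π hπ β hK₀o hK₀c σ hadm f hf 𝒯 h𝒯 hdense)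

end Head

end Summit.HodgeConjecture.HodgeConjecture.Cruxes.H413.F0P3SmoothPartIsotypic

end
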